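import Summits.QuantumFields.YangMills.Theorems.VirialFluxGapAssemblyOfCentralField
import Summits.QuantumFields.YangMills.Theorems.VirialFluxGapRingFrameDerivativeBounds
import Summits.QuantumFields.YangMills.Theorems.VirialFluxGapGradientEnergyBoundL4
import HarnessLib

/-!
# Route `VirialFluxGap` (YangMills): `PeriodicSoftness` FROM A CENTRAL FIELD PACKAGE — ASSEMBLY OF THE PATCHED EULER FIELD ON `X_fix`, PART V
# (the conclusion: absolute constants, the scale `A, a`, and w2's last-mile reduction)

Toward the deciding crux `VirialFluxGap.PeriodicSoftness` (item stmt-QuantumFields-24141).  ★★★ `periodicSoftness_of_centralField`: the crux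
holds BY NAME as soon as a «CENTRAL FIELD PACKAGE» is supplied — constants `K_C ≥ 1`, `q_C`, `L₀` and for every `L ≥ L₀`: a radius
`ρ ∈ [(K_C L^{q_C})⁻¹, 1/2]`, a window `t_C ≥ (K_C L^{q_C})⁻¹`, a rate `0 ≤ N ≤ K_C L^{q_C}`, `ε_C` with `ε_C·L⁴ ≤ 1/400`, and SMOOTH coefficient
functions `C_va` of the coordinates (`va : FixVar L × Fin 3`, frame ✓`fixFrameStd`) such that at every point `x` of `X_fix` in the CLOSED
`ρ`-CENTRAL WINDOW (all four regularity masses `≤ ρ²`, `F_fix x ≤ t_C`): (P2) drive `2(1 − ε_C)·F_fix x ≤ Σ_va C_va·g_va`, (P3) divergence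
`Σ_va ∂_va C_va ≤ 18L⁴ − 1/2`, (P4) mass monotonicity `−N·√(F_fix x) ≤ Σ_va C_va·∂_va m` for the four masses `m` (w2's ✓`linkMass k`, ✓`seamMass`).
Proof: the three absolute constants `C₃` (✓`exists_bound_frameD3_ringPoly`), `C₂` (✓`exists_frameD_sq_le_L4_ringDeficit`), `Dψ`
(✓`RegCutoff.exists_bound_deriv_deficitStep`), the scale `A := 2K_C² + 400 + 1032960·10⁴ + (C₃+1)² + 21⁵ + (Dψ+1) + (2C₂+2)`, `a := 2q_C + 20`,
then ✓`assembly_at_L` (Part IV) for every `L ≥ L₀` and w2's ✓`periodicSoftness_of_smoothFrameField_cutoff` with `c₁ = 7/32`, `K = 2A²⁰`, `q = 20a`.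

HONEST LABEL: a CONDITIONAL assembly — the central package (P2)–(P4) is a HYPOTHESIS (to be supplied by the w3 lineage: explicit field
`X_z + U` of memo `w3-g59-EXPLICIT-CENTRAL-FIELD-24141.md`); no stub ∕ crux ∕ rung ∕ summit is closed by this file; ⟨24141⟩, ⟨22884⟩ remain OPEN;
the Yang–Mills mass gap is NOT proved; no summit is proved by a line.  THEOREMS ONLY (0 `def`, 0 `sorry`), standard axioms.  Explicit-unit seat
`ym-line-fcl-p3` g41 (cell ym-idea-1, free hands; default assembler per LEAD ruling 2026-08-30T23:18Z), `--supports stmt-QuantumFields-24141`.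
References: [cite: Griffiths1964]; [cite: Luscher1983, §2]; [folklore].
-/

set_option autoImplicit false

noncomputable section

open scoped Matrix BigOperators ContDiff Topology Quaternion
open MeasureTheory Set Matrix
open Literature.MathematicalPhysics.QuantumFieldTheory hiding SU2
open Literature.MathematicalPhysics.QuantumLattice
open Literature.MathematicalPhysics.QuantumFieldTheory.SUNBakryEmery (expSU coe_expSU matTop)

namespace Summit.QuantumFields.YangMills.Theorems.VirialFluxGap.FrameHessian

open Summit.QuantumFields.YangMills.Theorems.FemtoTransferGap
open Summit.QuantumFields.YangMills.Theorems.FemtoTransferGap.TT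
open Summit.QuantumFields.YangMills.Theorems.FemtoTransferGap.TwoLattice
open Summit.QuantumFields.YangMills.Theorems.FemtoTransferGap.TwoLattice.Flat
open Summit.QuantumFields.YangMills.Theorems.VirialFluxGap.RingDeficit
open Summit.QuantumFields.YangMills.Theorems.VirialFluxGap.FrameDerivative
open Summit.QuantumFields.YangMills.Theorems.VirialFluxGap.ResolventField
open Summit.QuantumFields.YangMills.Theorems.VirialFluxGap.RegularValley
open Summit.QuantumFields.YangMills.Theorems.VirialFluxGap.FixFrame
open Summit.QuantumFields.YangMills.Theorems.VirialFluxGap.RegCutoff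
open Summit.QuantumFields.YangMills.Theorems.VirialFluxGap.FixField
open Summit.QuantumFields.YangMills.Theorems.VirialFluxGap.PatchingBudget

variable {L : ℕ} [NeZero L]

open scoped Matrix.Norms.Frobenius

/-! ## `PeriodicSoftness` from a central field package -/

/-- ★★★ **`PeriodicSoftness` FROM A CENTRAL FIELD PACKAGE.**  If for all large `L` there are a radius `ρ ∈ [(K_C L^{q_C})⁻¹, 1/2]`, a window
`t_C ≥ (K_C L^{q_C})⁻¹`, a rate `0 ≤ N ≤ K_C L^{q_C}`, `ε_C` with `ε_C·L⁴ ≤ 1/400`, and SMOOTH coefficient functions `C_va` of the coordinates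
such that on the closed `ρ`-central window of `X_fix` (all four regularity masses `≤ ρ²`, `F_fix ≤ t_C`): (P2) `2(1−ε_C)F_fix ≤ Σ_va C_va·g_va`,
(P3) `Σ_va ∂_va C_va ≤ 18L⁴ − 1/2`, (P4) `−N√F_fix ≤ Σ_va C_va·∂_va m` for the four masses `m` — then the deciding crux
`VirialFluxGap.PeriodicSoftness` holds BY NAME.  The generic resolvent field, the three cut-offs, the signed patching and the parameter choice
are discharged (`assembly_at_L`); the last mile is w2's ✓`periodicSoftness_of_smoothFrameField_cutoff`.  CONDITIONAL on the package; no field of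
the package is constructed here. [cite: Griffiths1964] [cite: Luscher1983, §2] -/
theorem periodicSoftness_of_centralField
    (h : ∃ K_C : ℝ, 1 ≤ K_C ∧ ∃ q_C : ℕ, ∃ L₀ : ℕ, ∀ (L : ℕ) [NeZero L], L₀ ≤ L →
      ∃ (ρ t_C N ε_C : ℝ)
        (C : FixVar L × Fin 3 → ((Fin (2 * L - 1 + 1) → Edge 3 L → Matrix (Fin 2) (Fin 2) ℂ) × (Site 3 L → Matrix (Fin 2) (Fin 2) ℂ)) → ℝ),
        (K_C * (L : ℝ) ^ q_C)⁻¹ ≤ ρ ∧ ρ ≤ 1 / 2 ∧ (K_C * (L : ℝ) ^ q_C)⁻¹ ≤ t_C ∧ 0 ≤ N ∧ N ≤ K_C * (L : ℝ) ^ q_C ∧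
        ε_C * (L : ℝ) ^ 4 ≤ 1 / 400 ∧ (∀ va, ContDiff ℝ ∞ (C va)) ∧
        ∀ x : (OffIdx L → SU2) × ((Fin (2 * L - 1) → GaugeConfig 3 L SU2) × (Site 3 L → SU2)),
          (∀ k : Fin 3, 1 - (su2Quat (wrapReps ((Fin.cons (glue x.1) x.2.1 : Fin (2 * L - 1 + 1) → GaugeConfig 3 L SU2) 0) k)).re ^ 2 ≤ ρ ^ 2) →
          1 - (su2Quat (x.2.2 0)).re ^ 2 ≤ ρ ^ 2 →
          ringDeficit L (fun _ => false) ((Fin.cons (glue x.1) x.2.1 : Fin (2 * L - 1 + 1) → GaugeConfig 3 L SU2), x.2.2) ≤ t_C →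
          2 * (1 - ε_C) * ringDeficit L (fun _ => false) ((Fin.cons (glue x.1) x.2.1 : Fin (2 * L - 1 + 1) → GaugeConfig 3 L SU2), x.2.2) ≤
              ∑ va, C va (ringCoord L ((Fin.cons (glue x.1) x.2.1 : Fin (2 * L - 1 + 1) → GaugeConfig 3 L SU2), x.2.2)) *
                frameGrad (L := L) fixFrameStd (ringCoord L ((Fin.cons (glue x.1) x.2.1 : Fin (2 * L - 1 + 1) → GaugeConfig 3 L SU2), x.2.2)) va ∧
            ∑ va, frameD (fixFrameStd va) (C va) (ringCoord L ((Fin.cons (glue x.1) x.2.1 : Fin (2 * L - 1 + 1) → GaugeConfig 3 L SU2), x.2.2)) ≤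
              18 * (L : ℝ) ^ 4 - 1 / 2 ∧
            (∀ k : Fin 3, -(N * Real.sqrt (ringDeficit L (fun _ => false) ((Fin.cons (glue x.1) x.2.1 : Fin (2 * L - 1 + 1) → GaugeConfig 3 L SU2), x.2.2))) ≤
              ∑ va, C va (ringCoord L ((Fin.cons (glue x.1) x.2.1 : Fin (2 * L - 1 + 1) → GaugeConfig 3 L SU2), x.2.2)) *
                frameD (fixFrameStd va) (linkMass k) (ringCoord L ((Fin.cons (glue x.1) x.2.1 : Fin (2 * L - 1 + 1) → GaugeConfig 3 L SU2), x.2.2))) ∧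
            -(N * Real.sqrt (ringDeficit L (fun _ => false) ((Fin.cons (glue x.1) x.2.1 : Fin (2 * L - 1 + 1) → GaugeConfig 3 L SU2), x.2.2))) ≤
              ∑ va, C va (ringCoord L ((Fin.cons (glue x.1) x.2.1 : Fin (2 * L - 1 + 1) → GaugeConfig 3 L SU2), x.2.2)) *
                frameD (fixFrameStd va) seamMass (ringCoord L ((Fin.cons (glue x.1) x.2.1 : Fin (2 * L - 1 + 1) → GaugeConfig 3 L SU2), x.2.2))) :
    Summit.QuantumFields.YangMills.Theses.VirialFluxGap.PeriodicSoftness := by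
  classical
  obtain ⟨K_C, hK_C, q_C, L₀, hpack⟩ := h
  obtain ⟨C₃, hC₃0, hC₃⟩ := exists_bound_frameD3_ringPoly
  obtain ⟨C₂, hC₂0, hC₂⟩ := exists_frameD_sq_le_L4_ringDeficit
  obtain ⟨Dψ, hDψ0, hDψ⟩ := _root_.Summit.QuantumFields.YangMills.Theorems.VirialFluxGap.RegCutoff.exists_bound_deriv_deficitStep
  obtain ⟨A, hA1, hA2, hA3, hA4, hA5, hA7, hA8⟩ : ∃ A : ℝ, 2 * K_C ^ 2 ≤ A ∧ 400 ≤ A ∧ 1032960 * 10000 ≤ A ∧ (C₃ + 1) ^ 2 ≤ A ∧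
      (21 : ℝ) ^ 5 ≤ A ∧ Dψ + 1 ≤ A ∧ 2 * C₂ + 2 ≤ A := by
    have hsq1 : 0 ≤ 2 * K_C ^ 2 := by positivity
    have hsq2 : 0 ≤ (C₃ + 1) ^ 2 := by positivity
    have h5 : (0 : ℝ) ≤ (21 : ℝ) ^ 5 := by positivity
    refine ⟨2 * K_C ^ 2 + 400 + 1032960 * 10000 + (C₃ + 1) ^ 2 + 21 ^ 5 + (Dψ + 1) + (2 * C₂ + 2), ?_, ?_, ?_, ?_, ?_, ?_, ?_⟩ <;>
      linarith only [hsq1, hsq2, h5, hDψ0, hC₂0]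
  obtain ⟨a, ha1, ha2⟩ : ∃ a : ℕ, 2 * q_C ≤ a ∧ 20 ≤ a := ⟨2 * q_C + 20, by omega, by omega⟩
  refine periodicSoftness_of_smoothFrameField_cutoff ⟨7 / 32, by norm_num, 2 * A ^ 20, ?_, ((20 * a : ℕ) : ℝ), ?_, L₀, fun L _ hL => ?_⟩
  · have hA1' : (1 : ℝ) ≤ A := by linarith only [hA2]
    have h1 : A ≤ A ^ 20 := le_self_pow₀ hA1' (by norm_num)
    linarith only [h1, hA2]
  · have : (400 : ℕ) ≤ 20 * a := by omega
    have h' : ((400 : ℕ) : ℝ) ≤ ((20 * a : ℕ) : ℝ) := by exact_mod_cast this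
    push_cast at h' ⊢
    linarith only [h']
  · obtain ⟨ρ, t_C, N, ε_C, C, hρlo, hρhi, htC, hN0, hN, hεC, hCs, hP⟩ := hpack L hL
    exact assembly_at_L (L := L) hC₃0 (hC₃ L) hC₂0 (hC₂ L) hDψ0 hDψ hK_C hA1 hA2 hA3 hA4 hA5 hA7 hA8 ha1 ha2
      hρlo hρhi htC hN0 hN hεC hCs hP

end Summit.QuantumFields.YangMills.Theorems.VirialFluxGap.FrameHessian

end
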